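import Mathlib
import HarnessLib
import Summits.HubbardSuperconductivity.HubbardSuperconductivity.Theorems.KLProgrammeKLRegimeEnginePairTransferPPRateSupport

/-!
# Route `KLProgramme` — ENGINE item stmt-HubbardSuperconductivity-20437 `KLRegimeEngineV17F2`, row (c) OUT-of-class package θ (`rowC_hexOut_of_pkgθ`,
# …EngineV17F2ClosersVGQOutT, PIN v11 slot (c)), binder row `hLr` = the frequency-LOCALISATION remainder `RL` (located #17 «(c)-OUT-RL-SHARE», cure (δ′)):
# PRODUCER-SIDE BRICK 2/2 — TOTAL and WINDOW mass of the pp slice-bubble RATE kernel `Br`, and row `hLr` from OFF/ON-window moduli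
# (cell gate-hubbard-kl, seat hubbard-kl-k3c2-p2 g29, technique «thermal-bar induction n ≤ nScales β + 1 with EngineBoundsAtV4S sums»)

WHY.  See …PPRateSupport (brick 1/2: pointwise size, frequency band and ball support of `Br`).  With the soft line of `Br` being the running member symbol `Φ_j(t)`
(admissible-in-size at scale `n`, `klmf_runningSymbol_mem`), the mass of `Br` is read by the soft sums of the EdgeFacts lane — TOTAL (`sum_softSymbol_mul_norm_propCT_le_of_frameOK`,
`15367·Λₙ·βL²`) and WINDOWED around any centre (`sum_window_softSymbol_mul_norm_propCT_le`, p1 g13: `15381(ρ/π + 1/L)·Λₙ·βL²`) — exactly as this lineage's ph rows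
`klms_weighted_*_norm_le_of_support_soft` (…PairTransferPHWindowRow) did for the direct term.  For the VERBATIM `Φ / Wd / Br` lambdas of θ (generic frame `K`):
* **`klpr_sum_norm_rate_le`** — TOTAL mass `Σ_z ‖Br j Qm t z‖ ≤ 2¹⁰·15367` (`FrameOK`, `klBetaMin ≤ β ≤ L`, `j ≥ n+1`; the joint-`(p,ω)` twin of k3c1-p1's `klmf_sum_norm_rate_le`,
  where the frequency sum sits inside the norm; `(Λₙ−Λₙ₊₁)Λₙ/Λ(t)² ≤ 12`);
* **`klpr_sum_window_norm_rate_le`** — WINDOW mass `Σ_{z : |z.1 − cen|_𝕋 ≤ ρ} ‖Br j Qm t z‖ ≤ 2¹⁰·15381·(ρ/π + 1/L)`: the soft line's window sits around `cen` (term `Φ·Ẇ`)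
  resp. around `Qm − cen` (term `Ẇ·Φ`, partner momentum `Qm − z.1`, reindexed by `(p, ν) ↦ (−ν, Qm − p)`);
* **`klpr_norm_sum_rate_mul_le_of_moduli`** — for ANY bracket `X : 𝕋_L × Mats → ℂ` with an OFF-window modulus `ε` and ON-window moduli `A w` (windows
  `|z.1 − cen w|_𝕋 ≤ ρw w`, asked only where `Br z ≠ 0`): `‖Σ_z Br z·X z‖ ≤ 2¹⁰·15367·ε + Σ_w 2¹⁰·15381·(ρw w/π + 1/L)·A w`;
* **`klpr_hLr_of_ppModuli`** — the same for θ's LITERAL `hLr` bracket, the moduli conditioned on the band `ω_{z.2}² ≤ (4Λₙ₊₁)²` and the ball `z.1 ∈ klBall L μ 0`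
  (the pp-arranged twins of θ's rows `hε1` / `hwin`): row `hLr` holds with `RL := 2¹⁰·15367·ε + Σ_w 2¹⁰·15381·(ρw w/π + 1/L)·A w`.
What remains for the E1 producer of `RL` after these two files: the two pp-moduli rows themselves (frequency-localisation gain of the dressed kernel products off / on
the windows) — the same KIND as θ's (ε)(W) rows — and their booking in `hShareEpsL` (cubic `2⁻ⁿ` slot, ROOM per …ClosersVGQOutT's docstring).  Real analysis over
landed rows; `V` is an arbitrary function (no effective-action content); nothing asserts (c), K3 or superconductivity.  0 kit · 0 lit.
-/
noncomputable section

namespace Summit.HubbardSuperconductivity.HubbardSuperconductivity.Theorems.KLRegimeSplit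

set_option linter.dupNamespace false -- summit = problem name (single-conjunct summit), D-0017

open Real Set Finset Complex Literature.MathematicalPhysics.QuantumLattice
open Literature.Probability.LatticeModels hiding torusSupNorm
open Summit.HubbardSuperconductivity.HubbardSuperconductivity.Theorems.KLProgrammeLegKernels
open Summit.HubbardSuperconductivity.HubbardSuperconductivity.Theorems.KLRegimeWick
open Summit.HubbardSuperconductivity.HubbardSuperconductivity.Theorems.TwoPointAssembly
open Summit.HubbardSuperconductivity.HubbardSuperconductivity.Theorems.DispersionFlow
open Summit.HubbardSuperconductivity.HubbardSuperconductivity.Theorems.EngineV8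

variable {L M : ℕ} [NeZero L] (β μ : ℝ) (K : TrigPolyC4v)

/-! ## §2 Total and windowed mass of the rate kernel -/

section Mass

variable {R : RenConsts} {U : ℝ} {N : ℕ}

omit [NeZero L] in
/-- Slice arithmetic: `(Λₙ − Λₙ₊₁)·Λₙ/Λ(t)² ≤ 12` for `Λ(t) ∈ [Λₙ₊₁, Λₙ]`, `Λₙ₊₁ = Λₙ/4`. -/
private theorem slice_ratio_le (n : ℕ) {t : ℝ} (ht : t ∈ Icc (0 : ℝ) 1) :
    (klScale klE0 n - klScale klE0 (n + 1)) * klScale klE0 n / (klScale klE0 n + t * (klScale klE0 (n + 1) - klScale klE0 n)) ^ 2 ≤ 12 := by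
  have h10 := (klmf_klScale_succ_pos_le n).2
  have h1 := (klmf_klScale_succ_pos_le n).1
  have hΛn : 0 < klScale klE0 n := klth_klScale_pos n
  have hsucc : klScale klE0 (n + 1) = klScale klE0 n / 4 := klth_klScale_succ n
  have hmem := klws_affine_mem_Icc h10 ht
  have hΛt : 0 < klScale klE0 n + t * (klScale klE0 (n + 1) - klScale klE0 n) := h1.trans_le hmem.1
  calc (klScale klE0 n - klScale klE0 (n + 1)) * klScale klE0 n / (klScale klE0 n + t * (klScale klE0 (n + 1) - klScale klE0 n)) ^ 2
      ≤ (klScale klE0 n - klScale klE0 (n + 1)) * klScale klE0 n / (klScale klE0 (n + 1)) ^ 2 :=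
        div_le_div_of_nonneg_left (by nlinarith) (by positivity) (pow_le_pow_left₀ h1.le hmem.1 2)
    _ = 12 := by rw [hsucc]; field_simp; ring

/-- **TOTAL MASS of the pp rate kernel, n-uniform**: `FrameOK` frame, `klBetaMin ≤ β ≤ L`, member `j ≥ n+1`, `t ∈ [0,1]` ⇒ `Σ_z ‖Br j Qm t z‖ ≤ 2¹⁰·15367`
(pointwise bound, both soft sums reindexed to `Σ_k |Φ_j(t)(k)|‖ĝ_K(k)‖ ≤ 15367·Λₙ·βL²` — `klmf_runningSymbol_mem` + `sum_softSymbol_mul_norm_propCT_le_of_frameOK` —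
and `(Λₙ−Λₙ₊₁)(256/3)Λₙ/Λ(t)² ≤ 2¹⁰`).  The joint `(p, ω)` twin of `klmf_sum_norm_rate_le` (there the frequency sum sits inside the norm). -/
theorem klpr_sum_norm_rate_le (hK : FrameOK R U N μ K) (hβ : klBetaMin ≤ β) (hβL : β ≤ L) (n : ℕ) {t : ℝ} (ht : t ∈ Icc (0 : ℝ) 1)
    (Φ : ℕ → ℝ → FreqMomentum L M → ℝ)
    (hΦ : Φ = fun j t k => (softSymbolCompl L M β μ K (n + 1) j) k + (hubbardCutoffWeightCT L M β μ K (klScale klE0 (n + 1)) k -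
        hubbardCutoffWeightCT L M β μ K (klScale klE0 n + t * (klScale klE0 (n + 1) - klScale klE0 n)) k))
    (Wd : ℝ → FreqMomentum L M → ℝ)
    (hWd : Wd = fun t k => deriv (fun Λ' : ℝ => hubbardCutoffWeightCT L M β μ K Λ' k) (klScale klE0 n + t * (klScale klE0 (n + 1) - klScale klE0 n)))
    (Br : ℕ → TorusSite 2 L → ℝ → TorusSite 2 L × MatsubaraIdx M → ℂ)
    (hBr : Br = fun j Qm t z => -(((((β * (L : ℝ) ^ 2 : ℝ) : ℂ)))⁻¹ * propCT L M β μ K (z.2, z.1) * propCT L M β μ K (z.2.rev, Qm - z.1)) *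
      ((((klScale klE0 (n + 1) - klScale klE0 n) * (-Wd t (z.2, z.1) * Φ j t (z.2.rev, Qm - z.1) - Φ j t (z.2, z.1) * Wd t (z.2.rev, Qm - z.1))) : ℝ) : ℂ))
    {j : ℕ} (hj : n + 1 ≤ j) (Qm : TorusSite 2 L) :
    ∑ z : TorusSite 2 L × MatsubaraIdx M, ‖Br j Qm t z‖ ≤ (2 : ℝ) ^ 10 * 15367 := by
  have hβ0 : 0 < β := pos_of_klBetaMin_le hβ
  have hL : (0 : ℝ) < L := hβ0.trans_le hβL
  have hβL2 : 0 < β * (L : ℝ) ^ 2 := by positivity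
  have hΛn : 0 < klScale klE0 n := klth_klScale_pos n
  have h10 := (klmf_klScale_succ_pos_le n).2
  have h1 := (klmf_klScale_succ_pos_le n).1
  have hmem := klws_affine_mem_Icc h10 ht
  have hΛt : 0 < klScale klE0 n + t * (klScale klE0 (n + 1) - klScale klE0 n) := h1.trans_le hmem.1
  have hdiff : 0 ≤ klScale klE0 n - klScale klE0 (n + 1) := by linarith
  set C : ℝ := (β * (L : ℝ) ^ 2)⁻¹ * ((klScale klE0 n - klScale klE0 (n + 1)) * (128 / 3 / (klScale klE0 n + t * (klScale klE0 (n + 1) - klScale klE0 n)) ^ 2))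
    with hC_def
  have hC : 0 ≤ C := by positivity
  set soft : FreqMomentum L M → ℝ := fun k => |Φ j t k| * ‖propCT L M β μ K k‖ with hsoft_def
  -- admissibility of the running member symbol at scale `n`
  have hΦmem : ∀ k, 0 ≤ Φ j t k ∧ Φ j t k ≤ 1 - hubbardCutoffWeightCT L M β μ K (klScale klE0 n) k := by
    intro k
    have h := klmf_runningSymbol_mem L M β μ K n (isSoftSymbol_compl (L := L) (M := M) β μ K hj).1 ht k
    rw [hΦ]; exact h
  have hS : ∑ k, soft k ≤ 15367 * klScale klE0 n * β * (L : ℝ) ^ 2 := sum_softSymbol_mul_norm_propCT_le_of_frameOK β μ K hK hβ hβL n hΦmem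
  -- the two reindexings
  have hre₁ : ∑ z : TorusSite 2 L × MatsubaraIdx M, soft (z.2, z.1) = ∑ k, soft k :=
    Fintype.sum_equiv (Equiv.prodComm _ _) _ _ (fun z => rfl)
  have hre₂ : ∑ z : TorusSite 2 L × MatsubaraIdx M, soft (z.2.rev, Qm - z.1) = ∑ k, soft k := by
    refine Fintype.sum_equiv ((Equiv.prodComm _ _).trans (Equiv.prodCongr Fin.revPerm (Equiv.subLeft Qm))) _ _ (fun z => ?_)
    rfl
  calc ∑ z : TorusSite 2 L × MatsubaraIdx M, ‖Br j Qm t z‖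
      ≤ ∑ z : TorusSite 2 L × MatsubaraIdx M, C * (soft (z.2.rev, Qm - z.1) + soft (z.2, z.1)) :=
        sum_le_sum fun z _ => klpr_norm_rate_le β μ K hβ0 n ht Φ Wd hWd Br hBr j Qm z
    _ = C * (∑ z : TorusSite 2 L × MatsubaraIdx M, soft (z.2.rev, Qm - z.1) + ∑ z : TorusSite 2 L × MatsubaraIdx M, soft (z.2, z.1)) := by
        rw [← Finset.mul_sum, sum_add_distrib]
    _ = C * (2 * ∑ k, soft k) := by rw [hre₁, hre₂]; ring
    _ ≤ C * (2 * (15367 * klScale klE0 n * β * (L : ℝ) ^ 2)) := mul_le_mul_of_nonneg_left (by linarith) hC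
    _ = 256 / 3 * 15367 * ((klScale klE0 n - klScale klE0 (n + 1)) * klScale klE0 n / (klScale klE0 n + t * (klScale klE0 (n + 1) - klScale klE0 n)) ^ 2) := by
        rw [hC_def]; field_simp; ring
    _ ≤ 256 / 3 * 15367 * 12 := mul_le_mul_of_nonneg_left (slice_ratio_le n ht) (by norm_num)
    _ = (2 : ℝ) ^ 10 * 15367 := by norm_num

/-- **WINDOW MASS of the pp rate kernel**: `FrameOK` frame, `klBetaMin ≤ β ≤ L`, member `j ≥ n+1`, `t ∈ [0,1]`, centre `cen`, radius `ρ ≥ 0` ⇒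
`Σ_{z : |z.1 − cen|_𝕋 ≤ ρ} ‖Br j Qm t z‖ ≤ 2¹⁰·15381·(ρ/π + 1/L)` — the fraction `ρ/π + 1/L` of the total (up to `15381/15367`): the soft line's window sits around `cen`
(term `Φ·Ẇ`) resp. around `Qm − cen` (term `Ẇ·Φ`, partner momentum `Qm − z.1`), each read by `sum_window_softSymbol_mul_norm_propCT_le` at scale `n`. -/
theorem klpr_sum_window_norm_rate_le (hK : FrameOK R U N μ K) (hβ : klBetaMin ≤ β) (hβL : β ≤ L) (n : ℕ) {t : ℝ} (ht : t ∈ Icc (0 : ℝ) 1)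
    (Φ : ℕ → ℝ → FreqMomentum L M → ℝ)
    (hΦ : Φ = fun j t k => (softSymbolCompl L M β μ K (n + 1) j) k + (hubbardCutoffWeightCT L M β μ K (klScale klE0 (n + 1)) k -
        hubbardCutoffWeightCT L M β μ K (klScale klE0 n + t * (klScale klE0 (n + 1) - klScale klE0 n)) k))
    (Wd : ℝ → FreqMomentum L M → ℝ)
    (hWd : Wd = fun t k => deriv (fun Λ' : ℝ => hubbardCutoffWeightCT L M β μ K Λ' k) (klScale klE0 n + t * (klScale klE0 (n + 1) - klScale klE0 n)))
    (Br : ℕ → TorusSite 2 L → ℝ → TorusSite 2 L × MatsubaraIdx M → ℂ)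
    (hBr : Br = fun j Qm t z => -(((((β * (L : ℝ) ^ 2 : ℝ) : ℂ)))⁻¹ * propCT L M β μ K (z.2, z.1) * propCT L M β μ K (z.2.rev, Qm - z.1)) *
      ((((klScale klE0 (n + 1) - klScale klE0 n) * (-Wd t (z.2, z.1) * Φ j t (z.2.rev, Qm - z.1) - Φ j t (z.2, z.1) * Wd t (z.2.rev, Qm - z.1))) : ℝ) : ℂ))
    {j : ℕ} (hj : n + 1 ≤ j) (Qm cen : TorusSite 2 L) {ρ : ℝ} (hρ : 0 ≤ ρ) :
    ∑ z ∈ (univ : Finset (TorusSite 2 L × MatsubaraIdx M)).filter (fun z => klTorusNorm L (z.1 - cen) ≤ ρ), ‖Br j Qm t z‖ ≤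
      (2 : ℝ) ^ 10 * 15381 * (ρ / π + ((L : ℝ))⁻¹) := by
  have hβ0 : 0 < β := pos_of_klBetaMin_le hβ
  have hL : (0 : ℝ) < L := hβ0.trans_le hβL
  have hβL2 : 0 < β * (L : ℝ) ^ 2 := by positivity
  have hΛn : 0 < klScale klE0 n := klth_klScale_pos n
  have h10 := (klmf_klScale_succ_pos_le n).2
  have h1 := (klmf_klScale_succ_pos_le n).1
  have hmem := klws_affine_mem_Icc h10 ht
  have hΛt : 0 < klScale klE0 n + t * (klScale klE0 (n + 1) - klScale klE0 n) := h1.trans_le hmem.1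
  have hdiff : 0 ≤ klScale klE0 n - klScale klE0 (n + 1) := by linarith
  have hc : 0 ≤ ρ / π + ((L : ℝ))⁻¹ := by positivity
  set C : ℝ := (β * (L : ℝ) ^ 2)⁻¹ * ((klScale klE0 n - klScale klE0 (n + 1)) * (128 / 3 / (klScale klE0 n + t * (klScale klE0 (n + 1) - klScale klE0 n)) ^ 2))
    with hC_def
  have hC : 0 ≤ C := by positivity
  set soft : FreqMomentum L M → ℝ := fun k => |Φ j t k| * ‖propCT L M β μ K k‖ with hsoft_def
  have hsoft0 : ∀ k, 0 ≤ soft k := fun k => mul_nonneg (abs_nonneg _) (norm_nonneg _)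
  have hΦmem : ∀ k, 0 ≤ Φ j t k ∧ Φ j t k ≤ 1 - hubbardCutoffWeightCT L M β μ K (klScale klE0 n) k := by
    intro k
    have h := klmf_runningSymbol_mem L M β μ K n (isSoftSymbol_compl (L := L) (M := M) β μ K hj).1 ht k
    rw [hΦ]; exact h
  -- the two windowed soft sums (centres `cen` and `Qm − cen`)
  have hW₁ : ∑ k ∈ (univ : Finset (FreqMomentum L M)).filter (fun k => klTorusNorm L (k.2 - cen) ≤ ρ), soft k ≤
      15381 * (ρ / π + ((L : ℝ))⁻¹) * klScale klE0 n * β * (L : ℝ) ^ 2 :=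
    sum_window_softSymbol_mul_norm_propCT_le β μ K hK hβ hβL n hΦmem cen hρ
  have hW₂ : ∑ k ∈ (univ : Finset (FreqMomentum L M)).filter (fun k => klTorusNorm L (k.2 - (Qm - cen)) ≤ ρ), soft k ≤
      15381 * (ρ / π + ((L : ℝ))⁻¹) * klScale klE0 n * β * (L : ℝ) ^ 2 :=
    sum_window_softSymbol_mul_norm_propCT_le β μ K hK hβ hβL n hΦmem (Qm - cen) hρ
  -- reindex the window sums of the two soft factors
  have hre₁ : ∑ z ∈ (univ : Finset (TorusSite 2 L × MatsubaraIdx M)).filter (fun z => klTorusNorm L (z.1 - cen) ≤ ρ), soft (z.2, z.1) =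
      ∑ k ∈ (univ : Finset (FreqMomentum L M)).filter (fun k => klTorusNorm L (k.2 - cen) ≤ ρ), soft k := by
    rw [sum_filter, sum_filter]
    exact Fintype.sum_equiv (Equiv.prodComm _ _) _ _ (fun z => rfl)
  have hre₂ : ∑ z ∈ (univ : Finset (TorusSite 2 L × MatsubaraIdx M)).filter (fun z => klTorusNorm L (z.1 - cen) ≤ ρ), soft (z.2.rev, Qm - z.1) =
      ∑ k ∈ (univ : Finset (FreqMomentum L M)).filter (fun k => klTorusNorm L (k.2 - (Qm - cen)) ≤ ρ), soft k := by
    rw [sum_filter, sum_filter]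
    refine Fintype.sum_equiv ((Equiv.prodComm _ _).trans (Equiv.prodCongr Fin.revPerm (Equiv.subLeft Qm))) _ _ (fun z => ?_)
    have hwin : klTorusNorm L (Qm - z.1 - (Qm - cen)) = klTorusNorm L (z.1 - cen) := by
      rw [sub_sub_sub_cancel_left, ← klTorusNorm_neg, neg_sub]
    change (if klTorusNorm L (z.1 - cen) ≤ ρ then soft (z.2.rev, Qm - z.1) else 0) =
      (if klTorusNorm L (Qm - z.1 - (Qm - cen)) ≤ ρ then soft (z.2.rev, Qm - z.1) else 0)
    rw [hwin]
  calc ∑ z ∈ (univ : Finset (TorusSite 2 L × MatsubaraIdx M)).filter (fun z => klTorusNorm L (z.1 - cen) ≤ ρ), ‖Br j Qm t z‖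
      ≤ ∑ z ∈ (univ : Finset (TorusSite 2 L × MatsubaraIdx M)).filter (fun z => klTorusNorm L (z.1 - cen) ≤ ρ), C * (soft (z.2.rev, Qm - z.1) + soft (z.2, z.1)) :=
        sum_le_sum fun z _ => klpr_norm_rate_le β μ K hβ0 n ht Φ Wd hWd Br hBr j Qm z
    _ = C * (∑ z ∈ (univ : Finset (TorusSite 2 L × MatsubaraIdx M)).filter (fun z => klTorusNorm L (z.1 - cen) ≤ ρ), soft (z.2.rev, Qm - z.1) +
          ∑ z ∈ (univ : Finset (TorusSite 2 L × MatsubaraIdx M)).filter (fun z => klTorusNorm L (z.1 - cen) ≤ ρ), soft (z.2, z.1)) := by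
        rw [← Finset.mul_sum, sum_add_distrib]
    _ ≤ C * (15381 * (ρ / π + ((L : ℝ))⁻¹) * klScale klE0 n * β * (L : ℝ) ^ 2 + 15381 * (ρ / π + ((L : ℝ))⁻¹) * klScale klE0 n * β * (L : ℝ) ^ 2) := by
        rw [hre₁, hre₂]; exact mul_le_mul_of_nonneg_left (add_le_add hW₂ hW₁) hC
    _ = 256 / 3 * 15381 * (ρ / π + ((L : ℝ))⁻¹) *
          ((klScale klE0 n - klScale klE0 (n + 1)) * klScale klE0 n / (klScale klE0 n + t * (klScale klE0 (n + 1) - klScale klE0 n)) ^ 2) := by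
        rw [hC_def]; field_simp; ring
    _ ≤ 256 / 3 * 15381 * (ρ / π + ((L : ℝ))⁻¹) * 12 := mul_le_mul_of_nonneg_left (slice_ratio_le n ht) (by positivity)
    _ = (2 : ℝ) ^ 10 * 15381 * (ρ / π + ((L : ℝ))⁻¹) := by ring

end Mass

/-! ## §3 Row `hLr` from OFF/ON-window moduli -/

section Moduli

variable {R : RenConsts} {U : ℝ} {N : ℕ}

/-- **The localisation sum from moduli (generic bracket)**: windows `|z.1 − cen w|_𝕋 ≤ ρw w` (`w < Nw`, `ρw ≥ 0`), a bracket `X`, an OFF-window modulus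
`‖X z‖ ≤ ε` (all windows missed) and ON-window moduli `‖X z‖ ≤ A w` (window `w` hit), both asked only where `Br j Qm t z ≠ 0` ⇒
`‖Σ_z Br j Qm t z·X z‖ ≤ 2¹⁰·15367·ε + Σ_w 2¹⁰·15381·(ρw w/π + 1/L)·A w` (total mass off the windows, window mass on each). -/
theorem klpr_norm_sum_rate_mul_le_of_moduli (hK : FrameOK R U N μ K) (hβ : klBetaMin ≤ β) (hβL : β ≤ L) (n : ℕ) {t : ℝ} (ht : t ∈ Icc (0 : ℝ) 1)
    (Φ : ℕ → ℝ → FreqMomentum L M → ℝ)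
    (hΦ : Φ = fun j t k => (softSymbolCompl L M β μ K (n + 1) j) k + (hubbardCutoffWeightCT L M β μ K (klScale klE0 (n + 1)) k -
        hubbardCutoffWeightCT L M β μ K (klScale klE0 n + t * (klScale klE0 (n + 1) - klScale klE0 n)) k))
    (Wd : ℝ → FreqMomentum L M → ℝ)
    (hWd : Wd = fun t k => deriv (fun Λ' : ℝ => hubbardCutoffWeightCT L M β μ K Λ' k) (klScale klE0 n + t * (klScale klE0 (n + 1) - klScale klE0 n)))
    (Br : ℕ → TorusSite 2 L → ℝ → TorusSite 2 L × MatsubaraIdx M → ℂ)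
    (hBr : Br = fun j Qm t z => -(((((β * (L : ℝ) ^ 2 : ℝ) : ℂ)))⁻¹ * propCT L M β μ K (z.2, z.1) * propCT L M β μ K (z.2.rev, Qm - z.1)) *
      ((((klScale klE0 (n + 1) - klScale klE0 n) * (-Wd t (z.2, z.1) * Φ j t (z.2.rev, Qm - z.1) - Φ j t (z.2, z.1) * Wd t (z.2.rev, Qm - z.1))) : ℝ) : ℂ))
    {j : ℕ} (hj : n + 1 ≤ j) (Qm : TorusSite 2 L)
    {Nw : ℕ} (cen : Fin Nw → TorusSite 2 L) (ρw A : Fin Nw → ℝ) (hρw : ∀ w, 0 ≤ ρw w) (hA : ∀ w, 0 ≤ A w) {ε : ℝ} (hε : 0 ≤ ε)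
    (X : TorusSite 2 L × MatsubaraIdx M → ℂ)
    (hoff : ∀ z, Br j Qm t z ≠ 0 → (∀ w, ρw w < klTorusNorm L (z.1 - cen w)) → ‖X z‖ ≤ ε)
    (hon : ∀ w z, Br j Qm t z ≠ 0 → klTorusNorm L (z.1 - cen w) ≤ ρw w → ‖X z‖ ≤ A w) :
    ‖∑ z : TorusSite 2 L × MatsubaraIdx M, Br j Qm t z * X z‖ ≤
      (2 : ℝ) ^ 10 * 15367 * ε + ∑ w, (2 : ℝ) ^ 10 * 15381 * (ρw w / π + ((L : ℝ))⁻¹) * A w := by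
  classical
  have htot := klpr_sum_norm_rate_le β μ K hK hβ hβL n ht Φ hΦ Wd hWd Br hBr hj Qm
  have hwin := fun w => klpr_sum_window_norm_rate_le β μ K hK hβ hβL n ht Φ hΦ Wd hWd Br hBr hj Qm (cen w) (hρw w)
  -- pointwise: `‖X z‖ ≤ ε + Σ_w 𝟙[window w]·A w` wherever `Br z ≠ 0`
  have hpt : ∀ z, ‖Br j Qm t z‖ * ‖X z‖ ≤ ‖Br j Qm t z‖ * (ε + ∑ w, if klTorusNorm L (z.1 - cen w) ≤ ρw w then A w else 0) := by
    intro z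
    by_cases hz : Br j Qm t z = 0
    · rw [hz, norm_zero, zero_mul, zero_mul]
    refine mul_le_mul_of_nonneg_left ?_ (norm_nonneg _)
    have hsum0 : 0 ≤ ∑ w, (if klTorusNorm L (z.1 - cen w) ≤ ρw w then A w else 0) :=
      sum_nonneg fun w _ => by split_ifs <;> [exact hA w; exact le_rfl]
    by_cases hw : ∃ w, klTorusNorm L (z.1 - cen w) ≤ ρw w
    · obtain ⟨w₀, hw₀⟩ := hw
      have h1 : ‖X z‖ ≤ A w₀ := hon w₀ z hz hw₀
      have h2 : A w₀ ≤ ∑ w, (if klTorusNorm L (z.1 - cen w) ≤ ρw w then A w else 0) := by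
        have h := single_le_sum (f := fun w => if klTorusNorm L (z.1 - cen w) ≤ ρw w then A w else 0)
          (fun w _ => by split_ifs <;> [exact hA w; exact le_rfl]) (mem_univ w₀)
        simp only [if_pos hw₀] at h
        exact h
      linarith
    · push Not at hw
      have h1 : ‖X z‖ ≤ ε := hoff z hz hw
      linarith
  calc ‖∑ z : TorusSite 2 L × MatsubaraIdx M, Br j Qm t z * X z‖
      ≤ ∑ z : TorusSite 2 L × MatsubaraIdx M, ‖Br j Qm t z‖ * ‖X z‖ := (norm_sum_le _ _).trans (le_of_eq (sum_congr rfl fun z _ => norm_mul _ _))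
    _ ≤ ∑ z : TorusSite 2 L × MatsubaraIdx M, ‖Br j Qm t z‖ * (ε + ∑ w, if klTorusNorm L (z.1 - cen w) ≤ ρw w then A w else 0) :=
        sum_le_sum fun z _ => hpt z
    _ = ε * ∑ z : TorusSite 2 L × MatsubaraIdx M, ‖Br j Qm t z‖ +
          ∑ w, A w * ∑ z ∈ (univ : Finset (TorusSite 2 L × MatsubaraIdx M)).filter (fun z => klTorusNorm L (z.1 - cen w) ≤ ρw w), ‖Br j Qm t z‖ := by
        simp only [mul_add, sum_add_distrib, Finset.mul_sum, sum_filter, mul_ite, mul_zero]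
        rw [sum_comm]
        congr 1
        · exact sum_congr rfl fun z _ => mul_comm _ _
        · exact sum_congr rfl fun w _ => sum_congr rfl fun z _ => by split_ifs <;> ring
    _ ≤ ε * ((2 : ℝ) ^ 10 * 15367) + ∑ w, A w * ((2 : ℝ) ^ 10 * 15381 * (ρw w / π + ((L : ℝ))⁻¹)) :=
        add_le_add (mul_le_mul_of_nonneg_left htot hε) (sum_le_sum fun w _ => mul_le_mul_of_nonneg_left (hwin w) (hA w))
    _ = (2 : ℝ) ^ 10 * 15367 * ε + ∑ w, (2 : ℝ) ^ 10 * 15381 * (ρw w / π + ((L : ℝ))⁻¹) * A w := by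
        congr 1
        · ring
        · exact sum_congr rfl fun w _ => by ring

variable [NeZero M]

/-- **ROW `hLr` FROM pp-MODULI** (θ's literal bracket).  On a `FrameOK` frame with `|K(p_k⃗)| ≤ A₀`, `Λₙ + A₀ ≤ e₀`, `klBetaMin ≤ β ≤ L`, member `j ≥ n+1`, `t ∈ [0,1]`,
for ANY leg functional `V`, legs `x y`, pair momentum `Qm`, windows `(cen w, ρw w)_{w<Nw}` and the pp-arranged twins of θ's rows `hε1` / `hwin` — an OFF-window modulus
`ε` and ON-window moduli `A w` of the pinned-minus-resolved bracket
`P(z.1) − R(z) = V[(ω₀,z.1)…]·V[…(ω₀,z.1)] − V[(z.2,z.1)…]·V[…(z.2,z.1)]` on the band `ω_{z.2}² ≤ (4Λₙ₊₁)²` and the ball `z.1 ∈ klBall L μ 0` — the row holds with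
`RL := 2¹⁰·15367·ε + Σ_w 2¹⁰·15381·(ρw w/π + 1/L)·A w`:
`‖Σ_z Br j Qm t z·(𝟙[z.1 ∈ klBall L μ 0]·P(z.1) − R(z))‖ ≤ RL` (off the ball and off the band `Br` vanishes, §1). -/
theorem klpr_hLr_of_ppModuli (hK : FrameOK R U N μ K) (hβ : klBetaMin ≤ β) (hβL : β ≤ L) (n : ℕ) {t : ℝ} (ht : t ∈ Icc (0 : ℝ) 1)
    {A₀ : ℝ} (hKA : ∀ k : TorusSite 2 L, |K.eval (latticeMomentum L k)| ≤ A₀) (hA₀ : klScale klE0 n + A₀ ≤ klE0)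
    (V : ℕ → ℝ → (Fin 4 → HubbardFieldIdx L M) → ℂ)
    (Φ : ℕ → ℝ → FreqMomentum L M → ℝ)
    (hΦ : Φ = fun j t k => (softSymbolCompl L M β μ K (n + 1) j) k + (hubbardCutoffWeightCT L M β μ K (klScale klE0 (n + 1)) k -
        hubbardCutoffWeightCT L M β μ K (klScale klE0 n + t * (klScale klE0 (n + 1) - klScale klE0 n)) k))
    (Wd : ℝ → FreqMomentum L M → ℝ)
    (hWd : Wd = fun t k => deriv (fun Λ' : ℝ => hubbardCutoffWeightCT L M β μ K Λ' k) (klScale klE0 n + t * (klScale klE0 (n + 1) - klScale klE0 n)))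
    (Br : ℕ → TorusSite 2 L → ℝ → TorusSite 2 L × MatsubaraIdx M → ℂ)
    (hBr : Br = fun j Qm t z => -(((((β * (L : ℝ) ^ 2 : ℝ) : ℂ)))⁻¹ * propCT L M β μ K (z.2, z.1) * propCT L M β μ K (z.2.rev, Qm - z.1)) *
      ((((klScale klE0 (n + 1) - klScale klE0 n) * (-Wd t (z.2, z.1) * Φ j t (z.2.rev, Qm - z.1) - Φ j t (z.2, z.1) * Wd t (z.2.rev, Qm - z.1))) : ℝ) : ℂ))
    {j : ℕ} (hj : n + 1 ≤ j) (Qm x y : TorusSite 2 L)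
    {Nw : ℕ} (cen : Fin Nw → TorusSite 2 L) (ρw A : Fin Nw → ℝ) (hρw : ∀ w, 0 ≤ ρw w) (hA : ∀ w, 0 ≤ A w) {ε : ℝ} (hε : 0 ≤ ε)
    (hoff : ∀ z : TorusSite 2 L × MatsubaraIdx M, z.1 ∈ klBall L μ 0 → matsubaraFreq β M z.2 ^ 2 ≤ (4 * klScale klE0 (n + 1)) ^ 2 →
      (∀ w, ρw w < klTorusNorm L (z.1 - cen w)) →
      ‖V j t ![(((omega0 M, z.1), 0), 0), ((((omega0 M).rev, Qm - z.1), 1), 0), ((((omega0 M).rev, Qm - x), 1), 1), (((omega0 M, x), 0), 1)] *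
          V j t ![(((omega0 M, y), 0), 0), ((((omega0 M).rev, Qm - y), 1), 0), ((((omega0 M).rev, Qm - z.1), 1), 1), (((omega0 M, z.1), 0), 1)] -
        V j t ![(((z.2, z.1), 0), 0), (((z.2.rev, Qm - z.1), 1), 0), ((((omega0 M).rev, Qm - x), 1), 1), (((omega0 M, x), 0), 1)] *
          V j t ![(((omega0 M, y), 0), 0), ((((omega0 M).rev, Qm - y), 1), 0), (((z.2.rev, Qm - z.1), 1), 1), (((z.2, z.1), 0), 1)]‖ ≤ ε)
    (hon : ∀ (w : Fin Nw) (z : TorusSite 2 L × MatsubaraIdx M), z.1 ∈ klBall L μ 0 → matsubaraFreq β M z.2 ^ 2 ≤ (4 * klScale klE0 (n + 1)) ^ 2 →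
      klTorusNorm L (z.1 - cen w) ≤ ρw w →
      ‖V j t ![(((omega0 M, z.1), 0), 0), ((((omega0 M).rev, Qm - z.1), 1), 0), ((((omega0 M).rev, Qm - x), 1), 1), (((omega0 M, x), 0), 1)] *
          V j t ![(((omega0 M, y), 0), 0), ((((omega0 M).rev, Qm - y), 1), 0), ((((omega0 M).rev, Qm - z.1), 1), 1), (((omega0 M, z.1), 0), 1)] -
        V j t ![(((z.2, z.1), 0), 0), (((z.2.rev, Qm - z.1), 1), 0), ((((omega0 M).rev, Qm - x), 1), 1), (((omega0 M, x), 0), 1)] *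
          V j t ![(((omega0 M, y), 0), 0), ((((omega0 M).rev, Qm - y), 1), 0), (((z.2.rev, Qm - z.1), 1), 1), (((z.2, z.1), 0), 1)]‖ ≤ A w) :
    ‖∑ z : TorusSite 2 L × MatsubaraIdx M, Br j Qm t z * ((if z.1 ∈ klBall L μ 0 then V j t ![(((omega0 M, z.1), 0), 0), ((((omega0 M).rev, Qm - z.1), 1), 0), ((((omega0 M).rev, Qm - x), 1), 1), (((omega0 M, x), 0), 1)] * V j t ![(((omega0 M, y), 0), 0), ((((omega0 M).rev, Qm - y), 1),
                  0), ((((omega0 M).rev, Qm - z.1), 1), 1), (((omega0 M, z.1), 0), 1)] else 0) - V j t ![(((z.2, z.1), 0), 0), (((z.2.rev, Qm - z.1), 1), 0), ((((omega0 M).rev, Qm - x), 1), 1), (((omega0 M, x), 0), 1)] * V j t ![(((omega0 M, y), 0), 0), ((((omega0 M).rev, Qm - y), 1), 0), (((z.2.rev, Qm - z.1), 1),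
                  1), (((z.2, z.1), 0), 1)])‖ ≤
      (2 : ℝ) ^ 10 * 15367 * ε + ∑ w, (2 : ℝ) ^ 10 * 15381 * (ρw w / π + ((L : ℝ))⁻¹) * A w := by
  refine klpr_norm_sum_rate_mul_le_of_moduli β μ K hK hβ hβL n ht Φ hΦ Wd hWd Br hBr hj Qm cen ρw A hρw hA hε _ (fun z hz hwz => ?_) (fun w z hz hwz => ?_)
  · have hball := klpr_mem_ball_of_rate_ne_zero β μ K n ht hKA hA₀ Φ hΦ Wd hWd Br hBr hj Qm hz
    have hband := klpr_sq_le_of_rate_ne_zero β μ K n ht Φ Wd hWd Br hBr j Qm hz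
    rw [if_pos hball]
    exact hoff z hball hband hwz
  · have hball := klpr_mem_ball_of_rate_ne_zero β μ K n ht hKA hA₀ Φ hΦ Wd hWd Br hBr hj Qm hz
    have hband := klpr_sq_le_of_rate_ne_zero β μ K n ht Φ Wd hWd Br hBr j Qm hz
    rw [if_pos hball]
    exact hon w z hball hband hwz


/-! ## §4 (appended, g29) The PROFILE form of the moduli: `‖X z‖ ≤ ε + Σ_w 𝟙[|z.1 − cen w|_𝕋 ≤ ρw w]·A w`

The frequency-localisation gain of a dressed kernel product is ADDITIVE over the loci of the loop momentum (one term `∝ 1/max(Λₙ₊₁, v·dist(z.1, locus_w))` per locus), so the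
natural producer statement is ONE profile row rather than an off-window modulus plus per-window moduli; the profile row is also what a package twin of θ with unchanged
by-type COUNT would carry in place of `hLr` (pen (R555)(2)(d)).  The proof of `klpr_norm_sum_rate_mul_le_of_moduli` passes through exactly this profile. -/

omit [NeZero M] in
/-- **The localisation sum from a modulus PROFILE (generic bracket)**: windows `|z.1 − cen w|_𝕋 ≤ ρw w` (`ρw ≥ 0`, `A w ≥ 0`, `ε ≥ 0`), a bracket `X` with
`‖X z‖ ≤ ε + Σ_w 𝟙[|z.1 − cen w|_𝕋 ≤ ρw w]·A w` wherever `Br j Qm t z ≠ 0` ⇒ `‖Σ_z Br j Qm t z·X z‖ ≤ 2¹⁰·15367·ε + Σ_w 2¹⁰·15381·(ρw w/π + 1/L)·A w`. -/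
theorem klpr_norm_sum_rate_mul_le_of_profile (hK : FrameOK R U N μ K) (hβ : klBetaMin ≤ β) (hβL : β ≤ L) (n : ℕ) {t : ℝ} (ht : t ∈ Icc (0 : ℝ) 1)
    (Φ : ℕ → ℝ → FreqMomentum L M → ℝ)
    (hΦ : Φ = fun j t k => (softSymbolCompl L M β μ K (n + 1) j) k + (hubbardCutoffWeightCT L M β μ K (klScale klE0 (n + 1)) k -
        hubbardCutoffWeightCT L M β μ K (klScale klE0 n + t * (klScale klE0 (n + 1) - klScale klE0 n)) k))
    (Wd : ℝ → FreqMomentum L M → ℝ)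
    (hWd : Wd = fun t k => deriv (fun Λ' : ℝ => hubbardCutoffWeightCT L M β μ K Λ' k) (klScale klE0 n + t * (klScale klE0 (n + 1) - klScale klE0 n)))
    (Br : ℕ → TorusSite 2 L → ℝ → TorusSite 2 L × MatsubaraIdx M → ℂ)
    (hBr : Br = fun j Qm t z => -(((((β * (L : ℝ) ^ 2 : ℝ) : ℂ)))⁻¹ * propCT L M β μ K (z.2, z.1) * propCT L M β μ K (z.2.rev, Qm - z.1)) *
      ((((klScale klE0 (n + 1) - klScale klE0 n) * (-Wd t (z.2, z.1) * Φ j t (z.2.rev, Qm - z.1) - Φ j t (z.2, z.1) * Wd t (z.2.rev, Qm - z.1))) : ℝ) : ℂ))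
    {j : ℕ} (hj : n + 1 ≤ j) (Qm : TorusSite 2 L)
    {Nw : ℕ} (cen : Fin Nw → TorusSite 2 L) (ρw A : Fin Nw → ℝ) (hρw : ∀ w, 0 ≤ ρw w) (hA : ∀ w, 0 ≤ A w) {ε : ℝ} (hε : 0 ≤ ε)
    (X : TorusSite 2 L × MatsubaraIdx M → ℂ)
    (hprof : ∀ z, Br j Qm t z ≠ 0 → ‖X z‖ ≤ ε + ∑ w, (if klTorusNorm L (z.1 - cen w) ≤ ρw w then A w else 0)) :
    ‖∑ z : TorusSite 2 L × MatsubaraIdx M, Br j Qm t z * X z‖ ≤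
      (2 : ℝ) ^ 10 * 15367 * ε + ∑ w, (2 : ℝ) ^ 10 * 15381 * (ρw w / π + ((L : ℝ))⁻¹) * A w := by
  classical
  have htot := klpr_sum_norm_rate_le β μ K hK hβ hβL n ht Φ hΦ Wd hWd Br hBr hj Qm
  have hwin := fun w => klpr_sum_window_norm_rate_le β μ K hK hβ hβL n ht Φ hΦ Wd hWd Br hBr hj Qm (cen w) (hρw w)
  have hpt : ∀ z, ‖Br j Qm t z‖ * ‖X z‖ ≤ ‖Br j Qm t z‖ * (ε + ∑ w, if klTorusNorm L (z.1 - cen w) ≤ ρw w then A w else 0) := by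
    intro z
    by_cases hz : Br j Qm t z = 0
    · rw [hz, norm_zero, zero_mul, zero_mul]
    exact mul_le_mul_of_nonneg_left (hprof z hz) (norm_nonneg _)
  calc ‖∑ z : TorusSite 2 L × MatsubaraIdx M, Br j Qm t z * X z‖
      ≤ ∑ z : TorusSite 2 L × MatsubaraIdx M, ‖Br j Qm t z‖ * ‖X z‖ := (norm_sum_le _ _).trans (le_of_eq (sum_congr rfl fun z _ => norm_mul _ _))
    _ ≤ ∑ z : TorusSite 2 L × MatsubaraIdx M, ‖Br j Qm t z‖ * (ε + ∑ w, if klTorusNorm L (z.1 - cen w) ≤ ρw w then A w else 0) :=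
        sum_le_sum fun z _ => hpt z
    _ = ε * ∑ z : TorusSite 2 L × MatsubaraIdx M, ‖Br j Qm t z‖ +
          ∑ w, A w * ∑ z ∈ (univ : Finset (TorusSite 2 L × MatsubaraIdx M)).filter (fun z => klTorusNorm L (z.1 - cen w) ≤ ρw w), ‖Br j Qm t z‖ := by
        simp only [mul_add, sum_add_distrib, Finset.mul_sum, sum_filter, mul_ite, mul_zero]
        rw [sum_comm]
        congr 1
        · exact sum_congr rfl fun z _ => mul_comm _ _
        · exact sum_congr rfl fun w _ => sum_congr rfl fun z _ => by split_ifs <;> ring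
    _ ≤ ε * ((2 : ℝ) ^ 10 * 15367) + ∑ w, A w * ((2 : ℝ) ^ 10 * 15381 * (ρw w / π + ((L : ℝ))⁻¹)) :=
        add_le_add (mul_le_mul_of_nonneg_left htot hε) (sum_le_sum fun w _ => mul_le_mul_of_nonneg_left (hwin w) (hA w))
    _ = (2 : ℝ) ^ 10 * 15367 * ε + ∑ w, (2 : ℝ) ^ 10 * 15381 * (ρw w / π + ((L : ℝ))⁻¹) * A w := by
        congr 1
        · ring
        · exact sum_congr rfl fun w _ => by ring

/-- **ROW `hLr` FROM A pp-MODULUS PROFILE** (θ's literal bracket; the COUNT-neutral twin of `klpr_hLr_of_ppModuli`).  Same frame / member / window data; ONE profile row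
`‖P(z.1) − R(z)‖ ≤ ε + Σ_w 𝟙[|z.1 − cen w|_𝕋 ≤ ρw w]·A w` for `z.1 ∈ klBall L μ 0`, `ω_{z.2}² ≤ (4Λₙ₊₁)²` ⇒
`‖Σ_z Br j Qm t z·(𝟙[z.1 ∈ klBall L μ 0]·P(z.1) − R(z))‖ ≤ 2¹⁰·15367·ε + Σ_w 2¹⁰·15381·(ρw w/π + 1/L)·A w`. -/
theorem klpr_hLr_of_ppProfile (hK : FrameOK R U N μ K) (hβ : klBetaMin ≤ β) (hβL : β ≤ L) (n : ℕ) {t : ℝ} (ht : t ∈ Icc (0 : ℝ) 1)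
    {A₀ : ℝ} (hKA : ∀ k : TorusSite 2 L, |K.eval (latticeMomentum L k)| ≤ A₀) (hA₀ : klScale klE0 n + A₀ ≤ klE0)
    (V : ℕ → ℝ → (Fin 4 → HubbardFieldIdx L M) → ℂ)
    (Φ : ℕ → ℝ → FreqMomentum L M → ℝ)
    (hΦ : Φ = fun j t k => (softSymbolCompl L M β μ K (n + 1) j) k + (hubbardCutoffWeightCT L M β μ K (klScale klE0 (n + 1)) k -
        hubbardCutoffWeightCT L M β μ K (klScale klE0 n + t * (klScale klE0 (n + 1) - klScale klE0 n)) k))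
    (Wd : ℝ → FreqMomentum L M → ℝ)
    (hWd : Wd = fun t k => deriv (fun Λ' : ℝ => hubbardCutoffWeightCT L M β μ K Λ' k) (klScale klE0 n + t * (klScale klE0 (n + 1) - klScale klE0 n)))
    (Br : ℕ → TorusSite 2 L → ℝ → TorusSite 2 L × MatsubaraIdx M → ℂ)
    (hBr : Br = fun j Qm t z => -(((((β * (L : ℝ) ^ 2 : ℝ) : ℂ)))⁻¹ * propCT L M β μ K (z.2, z.1) * propCT L M β μ K (z.2.rev, Qm - z.1)) *
      ((((klScale klE0 (n + 1) - klScale klE0 n) * (-Wd t (z.2, z.1) * Φ j t (z.2.rev, Qm - z.1) - Φ j t (z.2, z.1) * Wd t (z.2.rev, Qm - z.1))) : ℝ) : ℂ))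
    {j : ℕ} (hj : n + 1 ≤ j) (Qm x y : TorusSite 2 L)
    {Nw : ℕ} (cen : Fin Nw → TorusSite 2 L) (ρw A : Fin Nw → ℝ) (hρw : ∀ w, 0 ≤ ρw w) (hA : ∀ w, 0 ≤ A w) {ε : ℝ} (hε : 0 ≤ ε)
    (hprof : ∀ z : TorusSite 2 L × MatsubaraIdx M, z.1 ∈ klBall L μ 0 → matsubaraFreq β M z.2 ^ 2 ≤ (4 * klScale klE0 (n + 1)) ^ 2 →
      ‖V j t ![(((omega0 M, z.1), 0), 0), ((((omega0 M).rev, Qm - z.1), 1), 0), ((((omega0 M).rev, Qm - x), 1), 1), (((omega0 M, x), 0), 1)] *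
          V j t ![(((omega0 M, y), 0), 0), ((((omega0 M).rev, Qm - y), 1), 0), ((((omega0 M).rev, Qm - z.1), 1), 1), (((omega0 M, z.1), 0), 1)] -
        V j t ![(((z.2, z.1), 0), 0), (((z.2.rev, Qm - z.1), 1), 0), ((((omega0 M).rev, Qm - x), 1), 1), (((omega0 M, x), 0), 1)] *
          V j t ![(((omega0 M, y), 0), 0), ((((omega0 M).rev, Qm - y), 1), 0), (((z.2.rev, Qm - z.1), 1), 1), (((z.2, z.1), 0), 1)]‖ ≤
        ε + ∑ w, (if klTorusNorm L (z.1 - cen w) ≤ ρw w then A w else 0)) :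
    ‖∑ z : TorusSite 2 L × MatsubaraIdx M, Br j Qm t z * ((if z.1 ∈ klBall L μ 0 then V j t ![(((omega0 M, z.1), 0), 0), ((((omega0 M).rev, Qm - z.1), 1), 0), ((((omega0 M).rev, Qm - x), 1), 1), (((omega0 M, x), 0), 1)] * V j t ![(((omega0 M, y), 0), 0), ((((omega0 M).rev, Qm - y), 1),
                  0), ((((omega0 M).rev, Qm - z.1), 1), 1), (((omega0 M, z.1), 0), 1)] else 0) - V j t ![(((z.2, z.1), 0), 0), (((z.2.rev, Qm - z.1), 1), 0), ((((omega0 M).rev, Qm - x), 1), 1), (((omega0 M, x), 0), 1)] * V j t ![(((omega0 M, y), 0), 0), ((((omega0 M).rev, Qm - y), 1), 0), (((z.2.rev, Qm - z.1), 1),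
                  1), (((z.2, z.1), 0), 1)])‖ ≤
      (2 : ℝ) ^ 10 * 15367 * ε + ∑ w, (2 : ℝ) ^ 10 * 15381 * (ρw w / π + ((L : ℝ))⁻¹) * A w := by
  refine klpr_norm_sum_rate_mul_le_of_profile β μ K hK hβ hβL n ht Φ hΦ Wd hWd Br hBr hj Qm cen ρw A hρw hA hε _ (fun z hz => ?_)
  have hball := klpr_mem_ball_of_rate_ne_zero β μ K n ht hKA hA₀ Φ hΦ Wd hWd Br hBr hj Qm hz
  have hband := klpr_sq_le_of_rate_ne_zero β μ K n ht Φ Wd hWd Br hBr j Qm hz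
  rw [if_pos hball]
  exact hprof z hball hband

end Moduli

end Summit.HubbardSuperconductivity.HubbardSuperconductivity.Theorems.KLRegimeSplit

end
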